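import Mathlib.LinearAlgebra.Semisimple
import Mathlib.FieldTheory.Separable
import Literature.NumberTheory.Automorphic.ArthurParameters
import Literature.NumberTheory.GaloisRepresentations.LocalGaloisGroupProofs
import HarnessLib

/-!
# Arthur parameters: the L-parameter `φ_ψ` of an A-parameter exists (proof file)

Sibling proof file of `ArthurParameters`.  It **discharges the named fact**
`Literature.NumberTheory.Automorphic.LocalAParameter.exists_isLParameterOf` (Arthur 1989, §4,
pp. 25–26 and §6, p. 38; Arthur 2013, §1.3; Mok 2015, (2.2.11)): for a local A-parameter
`ψ : W_F × SL₂(ℂ) × SL₂(ℂ) → ᴸG` the recipe `φ_ψ(w) = ψ(w, diag(‖w‖^{1/2}, ‖w‖^{-1/2}))`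
defines an L-parameter (G19 `LParameter`).  Everything here is **proved**:

* `LocalAParameter.sqrtNormUnit_mul`, `sqrtNormUnit_eq_one_of_mem_inertia` — `w ↦ ‖w‖^{1/2}`
  is a character of `W_F`, trivial on inertia (G09 `WeilGroup.norm_mul`,
  `WeilGroup.norm_eq_one_iff_mem_inertia`, fed with the discharged facts `IsFrobPow.mul_holds`,
  `IsFrobPow.unique_holds` of `LocalGaloisGroupProofs`).
* `IsPolynomialHom.isSemisimple_toLin'_sl2Diag` — **an algebraic homomorphism
  `θ : SL₂(ℂ) → H ≤ GL_N(ℂ)` takes the diagonal torus to semisimple elements**: the entries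
  of `θ(diag(a, a⁻¹))^k = θ(diag(a^k, a^{-k}))` are fixed linear combinations of `k`-th powers
  of finitely many "weights" `λ ∈ Λ ⊂ ℂ` (the monomials of the defining polynomials evaluated
  at `diag(a, a⁻¹)`), so the separable polynomial `q = ∏_{λ ∈ Λ} (X - λ)` satisfies
  `M · q(M) = 0` for `M = θ(diag(a, a⁻¹))`, whence `q(M) = 0` (`M` is invertible) and
  Mathlib's `Module.End.isSemisimple_of_squarefree_aeval_eq_zero` applies.  (This is the
  elementary case of "morphisms of algebraic groups preserve semisimple elements" needed here.)
* `LocalAParameter.phiPsiHom`, `LocalAParameter.phiPsi` — the homomorphism `φ_ψ : W_F → ᴸG`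
  and the L-parameter `φ_ψ = (φ_ψ, θD)`: over `W_F → Γ_F` because the twist lies in `Ĝ`;
  commuting with Deligne's `SL₂` (`commute_θ`, `commute_φ_θD`); equal to `ψ|_{W_F}` on
  inertia, hence the canonical section on `ψ`'s open subgroup of inertia; Frobenius-semisimple
  because `(φ_ψ(w)^m).left = (φ(w)^m).left · θA(diag(t, t⁻¹))` with commuting factors, the
  first semisimple by `ψ.frobSemisimple`, the second by the torus lemma, and a product of
  commuting semisimple endomorphisms over the perfect field `ℂ` is semisimple
  (Mathlib `Module.End.IsSemisimple.mul_of_commute`).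
* `LocalAParameter.isLParameterOf_phiPsi`, `LocalAParameter.exists_isLParameterOf_holds` — the
  discharge; with `IsLParameterOf.unique` of `ArthurParameters`, `φ_ψ` exists uniquely
  (`LocalAParameter.existsUnique_isLParameterOf_holds`, `IsLParameterOf.eq_phiPsi`).

## References

* J. Arthur, *Unipotent automorphic representations: conjectures*, Astérisque 171–172 (1989),
  13–71 (read from Numdam, `AST_1989__171-172__13_0`): §4, pp. 25–26 — "For each
  `ψ ∈ Ψ(G)`, we define a parameter `φ_ψ ∈ Φ(G*)` by setting `φ_ψ(w)` equal to the image of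
  `ψ(w, diag(|w|^{1/2}, |w|^{-1/2}))`, `w ∈ W_ℝ`, in `ᴸG*`" (real groups); §6, p. 38 —
  "Suppose that `ψ ∈ Ψ(G)`. Then the restriction of `ψ` to `L_F` belongs to `Φ_temp(G*)`.
  Similarly, as in §4, we can define the objects `φ_ψ ∈ Φ(G*)` and `s_ψ`" (any local `F`,
  `L_F = W_F × SU(2)` for `F` non-archimedean, p. 37).  The equation numbers "(4.2)–(4.3)"
  quoted in `ArthurParameters` do not refer to this paper (there (4.2), (4.3) are character
  identities); the locator is corrected here. [Arthur1989]
* J. Arthur, *The endoscopic classification of representations: orthogonal and symplectic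
  groups*, AMS Colloquium Publ. 61 (2013), §1.3 (p. 24, as cited by Mok). [Arthur2013]
* C. P. Mok, *Endoscopic classification of representations of quasi-split unitary groups*,
  Mem. AMS 235 (2015), no. 1108, (2.2.11) (arXiv:1206.0882, p. 10: "we define the
  L-parameter `φ_ψ ∈ Φ(G)` associated to `ψ` by the formula
  `φ_ψ(σ) = ψ(σ, diag(|σ|^{1/2}, |σ|^{-1/2}))`"). [Mok2014]
* J. Tate, *Number theoretic background*, Corvallis 1979, (1.4.6) (`‖w‖`). [Corvallis1979]
* A. Borel, *Linear algebraic groups*, 2nd ed. (1991), §4.4 Thm. (Jordan decomposition is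
  preserved by morphisms), §8.4–8.5 (diagonalizable groups, weights). [folklore]
-/

noncomputable section

open Matrix Polynomial
open scoped MatrixGroups

namespace Literature.NumberTheory.Automorphic

/-! ### Algebraic homomorphisms on the diagonal torus of `SL₂` have semisimple values -/

section Torus

variable {N : ℕ} {H : Subgroup (GL (Fin N) ℂ)}

/-- **A product of two commuting semisimple matrices is semisimple** (as an endomorphism of
`K^n`, `K` perfect; Mathlib `Module.End.IsSemisimple.mul_of_commute` transported along
`Matrix.toLin'`).  Ref: Bourbaki, *Algèbre* VII §5.8, Cor. of Prop. 16. [folklore] -/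
theorem isSemisimple_toLin'_mul_of_commute {n : Type*} [Fintype n] [DecidableEq n]
    {K : Type*} [Field K] [PerfectField K] {A B : Matrix n n K} (hAB : A * B = B * A)
    (hA : Module.End.IsSemisimple (Matrix.toLin' A))
    (hB : Module.End.IsSemisimple (Matrix.toLin' B)) :
    Module.End.IsSemisimple (Matrix.toLin' (A * B)) := by
  have hcomm : Commute (Matrix.toLin' A) (Matrix.toLin' B) := by
    change _ * _ = _ * _
    rw [Module.End.mul_eq_comp, Module.End.mul_eq_comp, ← Matrix.toLin'_mul,
      ← Matrix.toLin'_mul, hAB]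
  rw [Matrix.toLin'_mul, ← Module.End.mul_eq_comp]
  exact hA.mul_of_commute hcomm hB

/-- The entries of `diag(a, a⁻¹)^{n+1} = diag(a^{n+1}, a^{-(n+1)})` are the `(n+1)`-st powers of
the entries of `diag(a, a⁻¹)` (also off the diagonal, as `0^{n+1} = 0`).
Ref: Borel, *Linear algebraic groups* (1991), §8.4. [folklore] -/
theorem sl2Diag_pow_succ_apply (a : ℂˣ) (n : ℕ) (i j : Fin 2) :
    ((sl2Diag (a ^ (n + 1)) : SL(2, ℂ)) : Matrix (Fin 2) (Fin 2) ℂ) i j =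
      (((sl2Diag a : SL(2, ℂ)) : Matrix (Fin 2) (Fin 2) ℂ) i j) ^ (n + 1) := by
  rw [coe_sl2Diag, coe_sl2Diag]
  fin_cases i <;> fin_cases j <;> simp

/-- The **weight** of an exponent vector `d` on the four matrix entries, at `diag(a, a⁻¹)`:
`∏_{kl} (diag(a, a⁻¹)_{kl})^{d_{kl}}` (`= a^{d₀₀ - d₁₁}` if `d` is supported on the diagonal,
`0` otherwise).
Ref: Borel, *Linear algebraic groups* (1991), §8.4–8.5 (characters of a torus). [folklore] -/
def sl2DiagWeight (a : ℂˣ) (d : (Fin 2 × Fin 2) →₀ ℕ) : ℂ :=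
  ∏ kl : Fin 2 × Fin 2, ((sl2Diag a : SL(2, ℂ)) : Matrix (Fin 2) (Fin 2) ℂ) kl.1 kl.2 ^ d kl

/-- Unfolding of `sl2DiagWeight`.
Ref: Borel, *Linear algebraic groups* (1991), §8.4–8.5. [folklore] -/
theorem sl2DiagWeight_def (a : ℂˣ) (d : (Fin 2 × Fin 2) →₀ ℕ) :
    sl2DiagWeight a d =
      ∏ kl : Fin 2 × Fin 2,
        ((sl2Diag a : SL(2, ℂ)) : Matrix (Fin 2) (Fin 2) ℂ) kl.1 kl.2 ^ d kl :=
  rfl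

/-- **Entries of `θ(diag(a, a⁻¹))^{n+1}` are linear combinations of powers of weights**: if the
`(i, j)` entry of `θ(s)` is the polynomial `p` in the entries of `s`, then
`(θ(diag(a, a⁻¹))^{n+1})_{ij} = ∑_{d ∈ supp p} p_d · (weight_d(a))^{n+1}`.
Ref: Borel, *Linear algebraic groups* (1991), §8.4–8.5 (weights of a torus action). [folklore] -/
theorem IsPolynomialHom.pow_succ_apply_eq_sum_weight (θ : SL(2, ℂ) →* H) (a : ℂˣ) (n : ℕ)
    (i j : Fin N) (p : MvPolynomial (Fin 2 × Fin 2) ℂ)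
    (hp : ∀ s : SL(2, ℂ), ((θ s : GL (Fin N) ℂ) : Matrix (Fin N) (Fin N) ℂ) i j =
      MvPolynomial.eval (fun ij => (s : Matrix (Fin 2) (Fin 2) ℂ) ij.1 ij.2) p) :
    ((((θ (sl2Diag a) : GL (Fin N) ℂ) : Matrix (Fin N) (Fin N) ℂ)) ^ (n + 1)) i j =
      ∑ d ∈ p.support, p.coeff d * sl2DiagWeight a d ^ (n + 1) := by
  have h1 : (((θ (sl2Diag a) : GL (Fin N) ℂ) : Matrix (Fin N) (Fin N) ℂ)) ^ (n + 1) =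
      ((θ (sl2Diag (a ^ (n + 1))) : GL (Fin N) ℂ) : Matrix (Fin N) (Fin N) ℂ) := by
    rw [map_pow, map_pow, Subgroup.coe_pow, Units.val_pow_eq_pow_val]
  rw [h1, hp, MvPolynomial.eval_eq']
  refine Finset.sum_congr rfl fun d _ => ?_
  congr 1
  rw [sl2DiagWeight_def, ← Finset.prod_pow]
  refine Finset.prod_congr rfl fun kl _ => ?_
  rw [sl2Diag_pow_succ_apply, ← pow_mul, ← pow_mul, mul_comm]

/-- **An algebraic homomorphism `θ : SL₂(ℂ) → H ≤ GL_N(ℂ)` maps the diagonal torus to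
semisimple elements**: `θ(diag(a, a⁻¹))` is a semisimple endomorphism of `ℂ^N` for every
`a ∈ ℂ^×`.  Proof: with `Λ` the finite set of weights `weight_d(a)` over all monomials `d` of
all defining polynomials, `q = ∏_{λ ∈ Λ} (X - λ)` is separable and `M · q(M) = 0` for
`M = θ(diag(a, a⁻¹))` (entrywise, by `pow_succ_apply_eq_sum_weight`), so `q(M) = 0` as `M`
is invertible, and an endomorphism killed by a squarefree polynomial is semisimple.
Ref: Borel, *Linear algebraic groups* (1991), §4.4, Thm., and §8.4 (images of semisimple
elements under morphisms are semisimple; elements of tori are semisimple). [folklore] -/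
theorem IsPolynomialHom.isSemisimple_toLin'_sl2Diag {θ : SL(2, ℂ) →* H}
    (hθ : IsPolynomialHom θ) (a : ℂˣ) :
    Module.End.IsSemisimple
      (Matrix.toLin' ((θ (sl2Diag a) : GL (Fin N) ℂ) : Matrix (Fin N) (Fin N) ℂ)) := by
  classical
  choose p hp using hθ
  set M : Matrix (Fin N) (Fin N) ℂ :=
    ((θ (sl2Diag a) : GL (Fin N) ℂ) : Matrix (Fin N) (Fin N) ℂ) with hM
  -- the finite set of weights and the separable polynomial vanishing exactly there
  set Λ : Finset ℂ := Finset.univ.biUnion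
    fun ij : Fin N × Fin N => (p ij.1 ij.2).support.image (sl2DiagWeight a) with hΛ
  set q : ℂ[X] := ∏ c ∈ Λ, (X - C c) with hq
  have hq_sep : q.Separable :=
    Polynomial.separable_prod_X_sub_C_iff'.mpr fun _ _ _ _ h => h
  have hq_root : ∀ i j, ∀ d ∈ (p i j).support, q.eval (sl2DiagWeight a d) = 0 := by
    intro i j d hd
    rw [hq, Polynomial.eval_prod]
    refine Finset.prod_eq_zero (i := sl2DiagWeight a d) ?_ (by simp)
    exact Finset.mem_biUnion.mpr
      ⟨(i, j), Finset.mem_univ _, Finset.mem_image.mpr ⟨d, hd, rfl⟩⟩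
  -- `M * q(M) = 0`, entrywise
  have hMq : M * aeval M q = 0 := by
    rw [Polynomial.aeval_eq_sum_range, Finset.mul_sum]
    ext i j
    simp only [Matrix.sum_apply, Matrix.zero_apply, mul_smul_comm, ← pow_succ',
      Matrix.smul_apply, smul_eq_mul]
    simp_rw [hM, IsPolynomialHom.pow_succ_apply_eq_sum_weight θ a _ i j (p i j) (hp i j),
      Finset.mul_sum]
    rw [Finset.sum_comm]
    refine Finset.sum_eq_zero fun d hd => ?_
    have hsum : ∑ k ∈ Finset.range (q.natDegree + 1),
        q.coeff k * ((p i j).coeff d * sl2DiagWeight a d ^ (k + 1)) =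
          (p i j).coeff d * sl2DiagWeight a d * q.eval (sl2DiagWeight a d) := by
      rw [Polynomial.eval_eq_sum_range, Finset.mul_sum]
      refine Finset.sum_congr rfl fun k _ => ?_
      ring
    rw [hsum, hq_root i j d hd, mul_zero]
  have hqM : aeval M q = 0 :=
    (Units.mul_right_eq_zero (θ (sl2Diag a) : GL (Fin N) ℂ)).mp hMq
  refine Module.End.isSemisimple_of_squarefree_aeval_eq_zero hq_sep.squarefree ?_
  have h := Polynomial.aeval_algHom_apply
    (Matrix.toLinAlgEquiv' : Matrix (Fin N) (Fin N) ℂ ≃ₐ[ℂ] ((Fin N → ℂ) →ₗ[ℂ] (Fin N → ℂ)))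
    M q
  rw [hqM, map_zero] at h
  exact h

end Torus

/-! ### The L-parameter `φ_ψ` -/

section Local

variable {F : Type*} [Field F] [ValuativeRel F] [TopologicalSpace F]
  [IsNonarchimedeanLocalField F]

namespace LocalAParameter

open GaloisRepresentations

variable {L : LGroupData F} (ψ : LocalAParameter L)

/-- `‖v w‖^{1/2} = ‖v‖^{1/2} ‖w‖^{1/2}`: `w ↦ ‖w‖^{1/2}` is a character `W_F → ℂ^×` (G09
`WeilGroup.norm_mul` with the discharged facts `IsFrobPow.mul_holds`, `IsFrobPow.unique_holds`).
Ref: Tate, *Number theoretic background* (Corvallis 1979), (1.4.6).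
[cite: Corvallis1979, (1.4.6)] -/
theorem sqrtNormUnit_mul (v w : WeilGroup F) :
    sqrtNormUnit (v * w) = sqrtNormUnit v * sqrtNormUnit w := by
  ext
  simp only [sqrtNormUnit, Units.val_mk0, Units.val_mul]
  rw [WeilGroup.norm_mul IsFrobPow.mul_holds IsFrobPow.unique_holds,
    Real.sqrt_mul (WeilGroup.norm_pos v).le, Complex.ofReal_mul]

/-- `‖u‖^{1/2} = 1` for `u` in the inertia group (`‖·‖ = 1` on `I_F`, G09
`WeilGroup.norm_eq_one_iff_mem_inertia`).
Ref: Tate, *Number theoretic background* (Corvallis 1979), (1.4.6).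
[cite: Corvallis1979, (1.4.6)] -/
theorem sqrtNormUnit_eq_one_of_mem_inertia {u : WeilGroup F} (hu : u ∈ WeilGroup.inertia F) :
    sqrtNormUnit u = 1 := by
  ext
  simp only [sqrtNormUnit, Units.val_mk0, Units.val_one]
  rw [(WeilGroup.norm_eq_one_iff_mem_inertia IsFrobPow.mul_holds IsFrobPow.unique_holds).mpr hu,
    Real.sqrt_one, Complex.ofReal_one]

/-- **Arthur's twist** `t_ψ(w) = θA(diag(‖w‖^{1/2}, ‖w‖^{-1/2})) ∈ Ĝ`, the `Ĝ`-component by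
which `φ_ψ(w)` differs from `ψ(w) = φ(w)`.
Ref: Arthur (1989), §4, pp. 25–26; Arthur (2013), §1.3; Mok (2015), (2.2.11).
[cite: Arthur1989, §4 pp. 25–26] -/
def arthurTwist (w : WeilGroup F) : L.dual :=
  ψ.θA (sl2Diag (sqrtNormUnit w))

/-- Unfolding of `arthurTwist`.
Ref: Arthur (1989), §4, pp. 25–26. [cite: Arthur1989, §4 pp. 25–26] -/
theorem arthurTwist_def (w : WeilGroup F) :
    ψ.arthurTwist w = ψ.θA (sl2Diag (sqrtNormUnit w)) :=
  rfl

/-- `t_ψ` is multiplicative (`‖·‖^{1/2}`, `sl2Diag` and `θA` are homomorphisms).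
Ref: Arthur (1989), §4, pp. 25–26. [cite: Arthur1989, §4 pp. 25–26] -/
theorem arthurTwist_mul (v w : WeilGroup F) :
    ψ.arthurTwist (v * w) = ψ.arthurTwist v * ψ.arthurTwist w := by
  rw [arthurTwist_def, sqrtNormUnit_mul, map_mul, map_mul, arthurTwist_def, arthurTwist_def]

/-- `t_ψ(w)^m = θA(diag(‖w‖^{m/2}, ‖w‖^{-m/2}))`.
Ref: Arthur (1989), §4, pp. 25–26. [cite: Arthur1989, §4 pp. 25–26] -/
theorem arthurTwist_pow (w : WeilGroup F) (m : ℕ) :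
    ψ.arthurTwist w ^ m = ψ.θA (sl2Diag (sqrtNormUnit w ^ m)) := by
  rw [arthurTwist_def, ← map_pow, ← map_pow]

/-- `t_ψ = 1` on inertia (`‖·‖ = 1` there).
Ref: Arthur (1989), §4, pp. 25–26; Tate (1979), (1.4.6). [cite: Arthur1989, §4 pp. 25–26] -/
theorem arthurTwist_eq_one_of_mem_inertia {u : WeilGroup F} (hu : u ∈ WeilGroup.inertia F) :
    ψ.arthurTwist u = 1 := by
  rw [arthurTwist_def, sqrtNormUnit_eq_one_of_mem_inertia hu, map_one, map_one]

/-- `φ(W_F)` commutes with the twist (it commutes with Arthur's `SL₂`, `commute_φ_θA`).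
Ref: Arthur (1989), §4. [cite: Arthur1989, §4] -/
theorem commute_φ_inl_arthurTwist (v w : WeilGroup F) :
    Commute (ψ.φ v) (SemidirectProduct.inl (ψ.arthurTwist w)) :=
  ψ.commute_φ_θA v _

/-- **The homomorphism `φ_ψ : W_F → ᴸG`**, `φ_ψ(w) = ψ(w, diag(‖w‖^{1/2}, ‖w‖^{-1/2}))
= φ(w) · (t_ψ(w), 1)`; a homomorphism because `t_ψ` is one and commutes with `φ(W_F)`.
Ref: Arthur (1989), §4, pp. 25–26; Arthur (2013), §1.3; Mok (2015), (2.2.11).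
[cite: Arthur1989, §4 pp. 25–26] -/
def phiPsiHom : WeilGroup F →* L.LGroup :=
  MonoidHom.mk' (fun w => ψ.φ w * SemidirectProduct.inl (ψ.arthurTwist w)) fun v w => by
    have hc := (ψ.commute_φ_inl_arthurTwist w v).eq
    calc ψ.φ (v * w) * SemidirectProduct.inl (ψ.arthurTwist (v * w))
        = ψ.φ v * (ψ.φ w * SemidirectProduct.inl (ψ.arthurTwist v)) *
            SemidirectProduct.inl (ψ.arthurTwist w) := by
          rw [map_mul, arthurTwist_mul, map_mul]; simp only [mul_assoc]
      _ = ψ.φ v * (SemidirectProduct.inl (ψ.arthurTwist v) * ψ.φ w) *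
            SemidirectProduct.inl (ψ.arthurTwist w) := by rw [hc]
      _ = ψ.φ v * SemidirectProduct.inl (ψ.arthurTwist v) *
            (ψ.φ w * SemidirectProduct.inl (ψ.arthurTwist w)) := by simp only [mul_assoc]

/-- Pointwise formula for `φ_ψ`.
Ref: Arthur (1989), §4, pp. 25–26. [cite: Arthur1989, §4 pp. 25–26] -/
@[simp] theorem phiPsiHom_apply (w : WeilGroup F) :
    ψ.phiPsiHom w = ψ.φ w * SemidirectProduct.inl (ψ.arthurTwist w) :=
  rfl

/-- `φ_ψ(w)^m = φ(w)^m · (t_ψ(w)^m, 1)` (the factors commute).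
Ref: Arthur (1989), §4, pp. 25–26; §6, p. 38. [cite: Arthur1989, §4 pp. 25–26, §6 p. 38] -/
theorem phiPsiHom_pow (w : WeilGroup F) (m : ℕ) :
    ψ.phiPsiHom w ^ m = ψ.φ w ^ m * SemidirectProduct.inl (ψ.arthurTwist w ^ m) := by
  rw [phiPsiHom_apply, (ψ.commute_φ_inl_arthurTwist w w).mul_pow, map_pow]

/-- The `Γ_F`-component of `φ_ψ(w)^m` is that of `φ(w)^m`.
Ref: Arthur (1989), §4, pp. 25–26; §6, p. 38. [cite: Arthur1989, §4 pp. 25–26, §6 p. 38] -/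
theorem phiPsiHom_pow_right (w : WeilGroup F) (m : ℕ) :
    (ψ.phiPsiHom w ^ m).right = (ψ.φ w ^ m).right := by
  rw [phiPsiHom_pow, SemidirectProduct.mul_right, SemidirectProduct.right_inl, mul_one]

/-- The `Ĝ`-component of `φ_ψ(w)^m` is `(φ(w)^m).left · t_ψ(w)^m` when the `Γ_F`-component of
`φ(w)^m` acts trivially on `Ĝ`.
Ref: Arthur (1989), §4, pp. 25–26; §6, p. 38. [cite: Arthur1989, §4 pp. 25–26, §6 p. 38] -/
theorem phiPsiHom_pow_left (w : WeilGroup F) (m : ℕ) (h : L.galAct (ψ.φ w ^ m).right = 1) :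
    (ψ.phiPsiHom w ^ m).left = (ψ.φ w ^ m).left * ψ.arthurTwist w ^ m := by
  rw [phiPsiHom_pow, SemidirectProduct.mul_left, SemidirectProduct.left_inl, h,
    MulAut.one_apply]

/-- `(φ(w)^m).left` commutes with `t_ψ(w)^m` in `Ĝ` when the `Γ_F`-component of `φ(w)^m` acts
trivially.  Ref: Arthur (1989), §4. [cite: Arthur1989, §4] -/
theorem left_pow_mul_arthurTwist_pow (w : WeilGroup F) (m : ℕ)
    (h : L.galAct (ψ.φ w ^ m).right = 1) :
    (ψ.φ w ^ m).left * ψ.arthurTwist w ^ m = ψ.arthurTwist w ^ m * (ψ.φ w ^ m).left := by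
  have hc : Commute (ψ.φ w ^ m) (SemidirectProduct.inl (ψ.arthurTwist w ^ m)) := by
    rw [map_pow]
    exact ((ψ.commute_φ_inl_arthurTwist w w).pow_right m).pow_left m
  have := congrArg SemidirectProduct.left hc.eq
  rwa [SemidirectProduct.mul_left, SemidirectProduct.left_inl, h, MulAut.one_apply,
    SemidirectProduct.mul_left, SemidirectProduct.left_inl, SemidirectProduct.right_inl,
    map_one, MulAut.one_apply] at this

/-- **Arthur's L-parameter `φ_ψ ∈ Φ(G)` attached to the A-parameter `ψ`**:
`φ_ψ(w) = ψ(w, diag(‖w‖^{1/2}, ‖w‖^{-1/2}))` on `W_F`, with the same Deligne `SL₂` as `ψ`.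
It lies over `W_F → Γ_F` (the twist is in `Ĝ`), commutes with `θD(SL₂)` (`commute_θ`,
`commute_φ_θD`), is the canonical section on `ψ`'s open subgroup of inertia (`‖·‖ = 1`
there), and is Frobenius-semisimple: `(φ_ψ(w)^m).left = (φ(w)^m).left · θA(diag(t, t⁻¹))` is
a product of commuting semisimple elements (`ψ.frobSemisimple`,
`IsPolynomialHom.isSemisimple_toLin'_sl2Diag`, `isSemisimple_toLin'_mul_of_commute`).
Ref: Arthur, *Unipotent automorphic representations: conjectures*, Astérisque 171–172 (1989),
§4, pp. 25–26 (definition of `φ_ψ`, `F = ℝ`) and §6, p. 38 (any local `F`); Arthur (2013),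
§1.3; Mok (2015), (2.2.11). [cite: Arthur1989, §4 pp. 25–26, §6 p. 38] -/
def phiPsi : LParameter L where
  φ := ψ.phiPsiHom
  θ := ψ.θD
  rightHom_φ w := by
    rw [phiPsiHom_apply, SemidirectProduct.mul_right, SemidirectProduct.right_inl, mul_one,
      ψ.rightHom_φ]
  comm w s := by
    rw [phiPsiHom_apply, mul_assoc, ← map_mul, arthurTwist_def, ← ψ.commute_θ, map_mul,
      ← mul_assoc, ψ.commute_φ_θD, mul_assoc]
  exists_isOpen := by
    obtain ⟨U, hU, hUo, hφU⟩ := ψ.exists_isOpen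
    exact ⟨U, hU, hUo, fun u hu => by
      rw [phiPsiHom_apply, ψ.arthurTwist_eq_one_of_mem_inertia (hU hu), map_one, mul_one,
        hφU u hu]⟩
  isPolynomial_θ := ψ.isPolynomial_θD
  frobSemisimple w m hm h := by
    rw [phiPsiHom_pow_right] at h
    have hG : Module.End.IsSemisimple (Matrix.toLin' (((ψ.arthurTwist w ^ m : L.dual) :
        GL (Fin L.rank) ℂ) : Matrix (Fin L.rank) (Fin L.rank) ℂ)) := by
      rw [arthurTwist_pow]
      exact ψ.isPolynomial_θA.isSemisimple_toLin'_sl2Diag _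
    rw [ψ.phiPsiHom_pow_left w m h, Subgroup.coe_mul, Units.val_mul]
    refine isSemisimple_toLin'_mul_of_commute ?_ (ψ.frobSemisimple w m hm h) hG
    rw [← Units.val_mul, ← Units.val_mul, ← Subgroup.coe_mul, ← Subgroup.coe_mul,
      ψ.left_pow_mul_arthurTwist_pow w m h]

/-- The Weil-group part of `φ_ψ` is `phiPsiHom ψ`.
Ref: Arthur (1989), §4, pp. 25–26. [cite: Arthur1989, §4 pp. 25–26] -/
@[simp] theorem phiPsi_φ : ψ.phiPsi.φ = ψ.phiPsiHom := rfl

/-- The Deligne `SL₂` of `φ_ψ` is that of `ψ`.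
Ref: Arthur (1989), §4, pp. 25–26. [cite: Arthur1989, §4 pp. 25–26] -/
@[simp] theorem phiPsi_θ : ψ.phiPsi.θ = ψ.θD := rfl

/-- `φ_ψ` **is** the L-parameter of `ψ` in the sense of `IsLParameterOf` (by construction).
Ref: Arthur (1989), §4, pp. 25–26; Arthur (2013), §1.3. [cite: Arthur1989, §4 pp. 25–26] -/
theorem isLParameterOf_phiPsi : ψ.IsLParameterOf ψ.phiPsi :=
  ⟨fun _ => rfl, rfl⟩

/-- **Discharge of the named fact `exists_isLParameterOf`** (Arthur 1989, §4, pp. 25–26 and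
§6, p. 38: `φ_ψ ∈ Φ(G*)`): every local A-parameter `ψ` has an L-parameter `φ_ψ`, namely
`phiPsi ψ`.
Ref: Arthur, *Unipotent automorphic representations: conjectures*, Astérisque 171–172 (1989),
§4, pp. 25–26 and §6, p. 38; Arthur (2013), §1.3; Mok (2015), (2.2.11).
[cite: Arthur1989, §4 pp. 25–26, §6 p. 38] -/
theorem exists_isLParameterOf_holds : ψ.exists_isLParameterOf :=
  ⟨ψ.phiPsi, ψ.isLParameterOf_phiPsi⟩

/-- `φ_ψ` exists **uniquely** (unconditional form of `existsUnique_isLParameterOf`).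
Ref: Arthur (1989), §4, pp. 25–26. [cite: Arthur1989, §4 pp. 25–26] -/
theorem existsUnique_isLParameterOf_holds : ∃! φ' : LParameter L, ψ.IsLParameterOf φ' :=
  ψ.existsUnique_isLParameterOf ψ.exists_isLParameterOf_holds

/-- Any L-parameter of `ψ` (in the sense of `IsLParameterOf`) is `phiPsi ψ`.
Ref: Arthur (1989), §4, pp. 25–26. [cite: Arthur1989, §4 pp. 25–26] -/
theorem IsLParameterOf.eq_phiPsi {φ' : LParameter L} (h : ψ.IsLParameterOf φ') :
    φ' = ψ.phiPsi :=
  h.unique ψ ψ.isLParameterOf_phiPsi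

end LocalAParameter

end Local

end Literature.NumberTheory.Automorphic
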